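import Summits.BirchSwinnertonDyer.BirchSwinnertonDyer.Theorems.ResidualThetaTransportAtTwoThetaLayerLambdaCongruenceAtTwoCrossingPairing
import Summits.BirchSwinnertonDyer.BirchSwinnertonDyer.Theorems.ResidualThetaTransportAtTwoThetaLayerLambdaCongruenceAtTwoFlowDecomposition
import Summits.BirchSwinnertonDyer.BirchSwinnertonDyer.Theorems.ResidualThetaTransportAtTwoThetaLayerLambdaCongruenceAtTwoManinSystemDualModel
import Literature.NumberTheory.EllipticCurves.ModularJacobianMultiplicityOneCosocleProofs
import Mathlib.LinearAlgebra.Dual.Lemmas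
import Mathlib.RingTheory.FiniteType
import HarnessLib

/-!
# Crux `ThetaLayerLambdaCongruenceAtTwo` (stmt-BirchSwinnertonDyer-20688, route ResidualThetaTransportAtTwo), line
# `birth` v13 — SD floor, brick S4 (part 6c): the crossing pairing on `H₁(X₀(N), ℤ)` is PERFECT (width seat bsd-wall-rtt-p3-w2 g8;
# `--supports stmt-BirchSwinnertonDyer-20688 --as helper`; closes nothing)

HONEST FRAMING. THEOREMS only. This is the PERFECTNESS half of the named fact `periodHomology_exists_heckeSelfAdjoint_perfectPairing`
(IP): a bi-additive `B : Λ →+ Λ →+ ℤ` with `x ↦ B(x, ·)` BIJECTIVE onto `Hom(Λ, ℤ)`, constructed from coset data (the signed crossing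
count of dual-tree walks with Farey paths). The Hecke self-adjointness half of IP is NOT here, so IP itself is not claimed; nothing
about any curve is asserted; BSD is not proved by any of this.

WHAT (`exists_perfect_crossingPairing`). For `N ≥ 1` there is `B : periodHomology N →+ (periodHomology N →+ ℤ)` with
`Function.Bijective B` and `B {∞, γ∞} {∞, γ'∞} = Σ_{g ∈ L} vec(D)(g⁻¹Γ₀(N))` for every dual chain `D` of `γ` and Manin chain `L` of
`γ'` (`…CrossingPairing`). SURJECTIVE: every `φ ∈ Hom(Λ, ℤ)` is the chain-sum map of an integral Manin system
(`exists_maninSystem_of_addMonoidHom_periodHomology`), which is the crossing vector of a dual chain of some `γ`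
(`exists_dualChain_of_maninSystem`), so `φ = B {∞, γ∞}`. INJECTIVE: `Λ` is a finite free `ℤ`-module (`moduleFinite/Free_int_periodHomologyHecke`)
and so is its dual, of the same rank; a surjective endomorphism of a finite module over a commutative ring is injective (Orzech /
Vasconcelos, `OrzechProperty.injective_of_surjective_endomorphism`).

References: [Merel1995Homologie] §1.2 («les produits d'intersection fournissent un accouplement unimodulaire»); J.-P. Serre, Trees, §I.5;
[Manin1972] Thm. 1.9.
-/

set_option autoImplicit false

noncomputable section

-- justification: the `Summit.BirchSwinnertonDyer.BirchSwinnertonDyer.…` path repeats a component (route-file convention)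
set_option linter.dupNamespace false

open scoped Classical MatrixGroups

open CongruenceSubgroup Matrix.SpecialLinearGroup ModularGroup
open Literature.NumberTheory.EllipticCurves.ModularForms

namespace Summit.BirchSwinnertonDyer.BirchSwinnertonDyer.Theorems.ThetaLayerLambdaCongruenceAtTwo

section Perfect

variable {N : ℕ} [NeZero N]

/-- `Λ = periodHomology N` is a finite free `ℤ`-module (transported from `periodHomologyHecke N`, same carrier). [folklore] -/
theorem moduleFinite_and_free_int_periodHomology :
    Module.Finite ℤ (periodHomology N) ∧ Module.Free ℤ (periodHomology N) := by
  let e : periodHomology N ≃+ periodHomologyHecke N :=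
    { toFun := fun x ↦ ⟨x.1, (mem_periodHomologyHecke N).mpr x.2⟩
      invFun := fun x ↦ ⟨x.1, (mem_periodHomologyHecke N).mp x.2⟩
      left_inv := fun x ↦ rfl
      right_inv := fun x ↦ rfl
      map_add' := fun x y ↦ rfl }
  haveI := moduleFinite_int_periodHomologyHecke N
  haveI := moduleFree_int_periodHomologyHecke N
  exact ⟨Module.Finite.equiv e.symm.toIntLinearEquiv, Module.Free.of_equiv e.symm.toIntLinearEquiv⟩

/-- **The crossing pairing on `H₁(X₀(N), ℤ)` is perfect.** There is a bi-additive `B : Λ →+ (Λ →+ ℤ)` (`Λ = periodHomology N`)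
which is BIJECTIVE as a map `Λ → Hom(Λ, ℤ)` and whose value on period functionals is the signed crossing count:
`B {∞, γ∞} {∞, γ'∞} = Σ_{g ∈ L} vec(D)(g⁻¹Γ₀(N))` for every dual chain `D` of `γ` and every Manin chain `L` of `γ'`.
(Poincaré duality for `X₀(N)(ℂ)` from coset data: the intersection pairing is unimodular.) [cite: Merel1995Homologie, §1.2]
[cite: Manin1972, Thm. 1.9] -/
theorem exists_perfect_crossingPairing :
    ∃ B : periodHomology N →+ (periodHomology N →+ ℤ), Function.Bijective B ∧ ∀ (γ γ' : Gamma0 N) (D L : List SL(2, ℤ)),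
      (∀ {A : Type} [AddCommGroup A] (G : SL(2, ℤ) → A), (∀ x, G (x * (S * T⁻¹)) = G x) → (∀ x, G (-x) = G x) →
        (D.map fun h ↦ G h - G (h * S)).sum = G (γ : SL(2, ℤ)) - G 1) →
      (∀ {A : Type} [AddCommGroup A] (F : SL(2, ℤ) → A), (∀ g, F (g * T) = F g) → (∀ g, F (-g) = F g) →
        (L.map fun g ↦ F g - F (g * S)).sum = F (γ' : SL(2, ℤ)) - F 1) →
      B ⟨periodFunctional N γ, periodFunctional_mem_periodHomology N γ⟩
        ⟨periodFunctional N γ', periodFunctional_mem_periodHomology N γ'⟩ =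
        (L.map fun g ↦ (D.map fun h ↦ (Pi.single ((h⁻¹ : SL(2, ℤ)) : Gamma0Coset N) (1 : ℤ) -
          Pi.single (((h * S)⁻¹ : SL(2, ℤ)) : Gamma0Coset N) 1 : Gamma0Coset N → ℤ)).sum ((g⁻¹ : SL(2, ℤ)) : Gamma0Coset N)).sum := by
  obtain ⟨B, hB⟩ := exists_biadditive_crossingPairing (N := N)
  have h3 : ∀ r : ℤ, r + r + r = 0 → r = 0 := fun r h ↦ by omega
  -- every element of `Λ` is a period functional, with a Manin chain
  have hsurjΛ : ∀ x : periodHomology N, ∃ γ : Gamma0 N, periodFunctional N γ = (x : Module.Dual ℂ (CuspForm (Gamma0 N) 2)) :=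
    fun x ↦ by
      have hx : (x : Module.Dual ℂ (CuspForm (Gamma0 N) 2)) ∈ (periodHomology N : Set (Module.Dual ℂ (CuspForm (Gamma0 N) 2))) :=
        x.2
      rw [coe_periodHomology_eq_range] at hx
      exact hx
  -- SURJECTIVITY
  have hsurj : Function.Surjective B := by
    intro φ
    obtain ⟨M, hM1, hM2, -, -, hφ⟩ := exists_maninSystem_of_addMonoidHom_periodHomology (N := N) φ h3
    obtain ⟨γ, D, hD, hvec⟩ := exists_dualChain_of_maninSystem M hM1 hM2
    refine ⟨⟨periodFunctional N γ, periodFunctional_mem_periodHomology N γ⟩, ?_⟩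
    ext x
    obtain ⟨γ', hγ'⟩ := hsurjΛ x
    obtain ⟨L, hL⟩ := exists_maninChain.{0} (γ' : SL(2, ℤ))
    have hx : x = ⟨periodFunctional N γ', periodFunctional_mem_periodHomology N γ'⟩ := Subtype.ext hγ'.symm
    rw [hx, hB γ γ' D L hD hL, hφ γ' L hL]
    congr 1
    exact List.map_congr_left fun g _ ↦ hvec _
  refine ⟨B, ⟨?_, hsurj⟩, hB⟩
  -- INJECTIVITY: ranks
  obtain ⟨hfin, hfree⟩ := moduleFinite_and_free_int_periodHomology (N := N)
  haveI := hfin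
  haveI := hfree
  let b := Module.Free.chooseBasis ℤ (periodHomology N)
  let ψ : Module.Dual ℤ (periodHomology N) ≃ₗ[ℤ] periodHomology N := b.dualBasis.repr.trans b.repr.symm
  let δ : (periodHomology N →+ ℤ) ≃ₗ[ℤ] Module.Dual ℤ (periodHomology N) := addMonoidHomLequivInt ℤ
  let f : periodHomology N →ₗ[ℤ] periodHomology N := ψ.toLinearMap ∘ₗ δ.toLinearMap ∘ₗ B.toIntLinearMap
  have hf : Function.Surjective f := by
    change Function.Surjective (ψ ∘ δ ∘ B)
    exact ψ.surjective.comp (δ.surjective.comp hsurj)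
  have hfi := OrzechProperty.injective_of_surjective_endomorphism f hf
  intro x y hxy
  apply hfi
  change ψ (δ (B x)) = ψ (δ (B y))
  rw [hxy]

end Perfect

end Summit.BirchSwinnertonDyer.BirchSwinnertonDyer.Theorems.ThetaLayerLambdaCongruenceAtTwo

end
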